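import Literature.Geometry.Riemannian.SurgicalSolutionsBase
import Literature.Geometry.Riemannian.SurgicalSolutionsCount
import Literature.Geometry.Riemannian.RicciFlowSingularTimeHolds
import HarnessLib

/-!
# Chen–Zhu's Thm. 5.6: the stage time bound and the base, with Topping's 3.2.x discharged
(topic `Geometry/Riemannian`; proof-only)

`SurgicalSolutionsCount.lean` carries the time bound of Chen–Zhu 2006, p. 30 (`T ≤ 2/R_min(0)`
across the stages) modulo the named facts `ricciFlow_scalarCurvature_lowerBound` (Topping 2006,
Thm. 3.2.1) and `ricciFlow_singularTime_le` (Cor. 3.2.4), and `SurgicalSolutionsBase.lean` the base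
of the induction of §5 (a first stage with the a priori assumptions for every simply connected PIC
metric) modulo, in addition, `exists_pos_le_scalarCurvature_of_hasPositiveIsotropicCurvature`.
All three facts are now theorems (`RicciFlowScalarCurvatureEvolution.lean`,
`RicciFlowSingularTimeHolds.lean`, `RicciFlowScalarCurvatureHolds.lean`), so the corresponding
hypotheses are discharged here:

* `stage_endTime_le'`, `stage_scalarCurvature_ge'` — the p. 30 time bound and the propagated lower
  bound `R ≥ α/(1 − α(t₀+t)/2)` for a stage, closed;
* `exists_first_stage_chenZhuAPriori'` — the base of §5, p. 26, now modulo exactly the four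
  analytic facts `ricciFlow_maximal_existence` (maximal solutions), `ricciFlow_preserves_positiveIsotropicCurvature`
  (Hamilton 1997), `hamilton_chenZhu_pinching` (Lemma 2.1) and
  `chenZhu_aprioriAssumptions_smoothSolution` (Thm. 4.1).

Together with `RicciFlowVolume.lean` (`V(t) ≤ V(0)`, p. 43) this leaves, for the statement of
Thm. 5.6 (the conclusion of `chenZhu_surgicalSolution_existence_of_step`; Thm. 5.6 is not a named
fact of the tree, D-0026 — see `SurgicalSolutions.lean`) and hence for the named fact
`chenZhu_ricciFlowWithSurgery` (Thm. 1.1, via `chenZhu_ricciFlowWithSurgery_of_step`), the surgery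
step at a singular time (Lemma 5.2, Lemma 5.3, procedures (1)–(4) with the surgery-local volume
accounting) and Prop. 5.4.

## References

* B.-L. Chen, X.-P. Zhu, *Ricci flow with surgery on four-manifolds with positive isotropic
  curvature*, J. Differential Geom. 74 (2006) (arXiv:math/0504478), §5, pp. 26, 30, 43. [ChenZhu2006]
* P. Topping, *Lectures on the Ricci flow*, LMS Lecture Note Series 325, CUP 2006, Thm. 3.2.1,
  Cor. 3.2.4 (p. 36). [Topping2006]
-/

noncomputable section

open Bundle Set Function TopologicalSpace
open scoped Manifold ContDiff Topology

namespace Literature.Geometry.Riemannian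

open Lorentzian

universe u

section TimeBound

variable (M : Type u) [TopologicalSpace M] [T2Space M] [SecondCountableTopology M] [CompactSpace M]
  [Nonempty M] [ChartedSpace (EuclideanSpace ℝ (Fin 4)) M] [IsManifold (𝓡 4) ∞ M]

/-- **A stage started at absolute time `t₀` with `R ≥ α/(1 − α t₀/2)` ends by absolute time
`2/α`**, closed form of `stage_endTime_le` (Chen–Zhu 2006, p. 30; Topping's Cor. 3.2.4 is the
theorem `ricciFlow_singularTime_le_holds`). [cite: ChenZhu2006, §5, p. 30] [cite: Topping2006, Cor. 3.2.4] -/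
theorem stage_endTime_le' {T : ℝ} (hT : 0 < T)
    (g : ℝ → PseudoRiemannianMetric (𝓡 4) ∞ (EuclideanSpace ℝ (Fin 4)) (TangentSpace (𝓡 4) : M → Type _))
    (cov : ℝ → CovariantDerivative (𝓡 4) (EuclideanSpace ℝ (Fin 4)) (TangentSpace (𝓡 4) : M → Type _))
    (hflow : IsRicciFlow g cov (Ico 0 T)) (hR : ∀ t ∈ Ico 0 T, (g t).IsRiemannian) {α t₀ : ℝ}
    (hα : 0 < α) (ht₀ : α * t₀ < 2)
    (h0 : ∀ x : M, α / (1 - α * t₀ / 2) ≤ (g 0).scalarCurvatureWith (cov 0) x) :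
    t₀ + T ≤ 2 / α :=
  stage_endTime_le M ricciFlow_singularTime_le_holds hT g cov hflow hR hα ht₀ h0

/-- **The lower bound `R ≥ α/(1 − α(t₀ + t)/2)` propagates along the stage**, closed form of
`stage_scalarCurvature_ge` (Chen–Zhu 2006, p. 30; Topping's Thm. 3.2.1 and Cor. 3.2.4 are the
theorems `ricciFlow_scalarCurvature_lowerBound_holds`, `ricciFlow_singularTime_le_holds`).
[cite: ChenZhu2006, §5, p. 30] [cite: Topping2006, Thm. 3.2.1] -/
theorem stage_scalarCurvature_ge' {T : ℝ} (hT : 0 < T)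
    (g : ℝ → PseudoRiemannianMetric (𝓡 4) ∞ (EuclideanSpace ℝ (Fin 4)) (TangentSpace (𝓡 4) : M → Type _))
    (cov : ℝ → CovariantDerivative (𝓡 4) (EuclideanSpace ℝ (Fin 4)) (TangentSpace (𝓡 4) : M → Type _))
    (hflow : IsRicciFlow g cov (Ico 0 T)) (hR : ∀ t ∈ Ico 0 T, (g t).IsRiemannian) {α t₀ : ℝ}
    (hα : 0 < α) (ht₀ : α * t₀ < 2)
    (h0 : ∀ x : M, α / (1 - α * t₀ / 2) ≤ (g 0).scalarCurvatureWith (cov 0) x) :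
    ∀ t ∈ Ico 0 T, α * (t₀ + t) < 2 ∧
      ∀ x : M, α / (1 - α * (t₀ + t) / 2) ≤ (g t).scalarCurvatureWith (cov t) x :=
  stage_scalarCurvature_ge M ricciFlow_scalarCurvature_lowerBound_holds
    ricciFlow_singularTime_le_holds hT g cov hflow hR hα ht₀ h0

end TimeBound

/-- **A first stage for every closed simply connected PIC 4-manifold**, closed form of
`exists_first_stage_chenZhuAPriori` (Chen–Zhu 2006, §5, p. 26: the maximal smooth solution from
`g₀` satisfies the a priori assumptions): the hypotheses `ricciFlow_singularTime_le` (Topping,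
Cor. 3.2.4) and `exists_pos_le_scalarCurvature_of_hasPositiveIsotropicCurvature` (Hamilton 1997,
§1.2) of that theorem are now the theorems `ricciFlow_singularTime_le_holds`,
`exists_pos_le_scalarCurvature_of_hasPositiveIsotropicCurvature_holds`; what remains assumed is
exactly `ricciFlow_maximal_existence`, `ricciFlow_preserves_positiveIsotropicCurvature`,
`hamilton_chenZhu_pinching` (Lemma 2.1) and `chenZhu_aprioriAssumptions_smoothSolution`
(Thm. 4.1). [cite: ChenZhu2006, §5, p. 26] -/
theorem exists_first_stage_chenZhuAPriori'
    (h₀ : ricciFlow_maximal_existence.{0, 0, 0})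
    (h₁ : ricciFlow_preserves_positiveIsotropicCurvature.{0}) (h₂ : hamilton_chenZhu_pinching.{0})
    (h₃ : chenZhu_aprioriAssumptions_smoothSolution) :
    ∃ η : ℝ, 0 < η ∧ ∃ ε₀ : ℝ, 0 < ε₀ ∧ ∀ ε : ℝ, 0 < ε → ε ≤ ε₀ → ∃ C₁ C₂ : ℝ, 0 < C₁ ∧ 0 < C₂ ∧
      ∀ (M : Type) [TopologicalSpace M] [T2Space M] [SecondCountableTopology M] [CompactSpace M]
        [ChartedSpace (EuclideanSpace ℝ (Fin 4)) M] [IsManifold (𝓡 4) ∞ M] [SimplyConnectedSpace M]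
        [MeasurableSpace M] [BorelSpace M]
        (g₀ : PseudoRiemannianMetric (𝓡 4) ∞ (EuclideanSpace ℝ (Fin 4))
          (TangentSpace (𝓡 4) : M → Type _)),
        g₀.IsRiemannian → g₀.HasPositiveIsotropicCurvature →
          ∃ ρ Λ P : ℝ, 0 < ρ ∧ 0 < Λ ∧ 0 < P ∧
            ∃ r : ℝ → ℝ, (∀ t ∈ Ici (0 : ℝ), 0 < r t) ∧ AntitoneOn r (Ici 0) ∧
              ∃ (g : ℝ → PseudoRiemannianMetric (𝓡 4) ∞ (EuclideanSpace ℝ (Fin 4))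
                  (TangentSpace (𝓡 4) : M → Type _))
                (cov : ℝ → CovariantDerivative (𝓡 4) (EuclideanSpace ℝ (Fin 4))
                  (TangentSpace (𝓡 4) : M → Type _)) (T : ℝ),
                IsMaximalRicciFlow g cov T ∧ g 0 = g₀ ∧
                  ChenZhuAPriori ⟨ε, C₁, C₂, η, ρ, Λ, P, r⟩ g cov T 0 :=
  exists_first_stage_chenZhuAPriori h₀ ricciFlow_singularTime_le_holds
    exists_pos_le_scalarCurvature_of_hasPositiveIsotropicCurvature_holds h₁ h₂ h₃

end Literature.Geometry.Riemannian

end
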